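import Summits.QuantumFields.BalabanUV.Beta.GAN24.DressedStepFaceChargesWeighted
import Summits.QuantumFields.BalabanUV.Beta.GAN24.BiStencilZeroMode
import Summits.QuantumFields.BalabanUV.Beta.GAN24.FourFaceSourceWords

/-!
# `BalabanUV.Beta.GAN24.FourFaceSourceWordsDeep` — binder row G-an2-4 ∕ (CONV-C), W-slot (α-0), ROW (C)sym AT LEVELS `≥ 1` (rows T6-STEP of the OWNER's
# two-index tower, RULING R-gan24p1-g40-1): **leaf-06 K6c AT EVERY COARSE FACE PERIOD `P`** — road-P2 g50's face read `FF_P` (cell `box P`, one conjunctive exit-face mask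
# at period `P` on the four coarse slots: `CombChargeTowerStepDeep.faceRead_member_succ`) of the dressed one-step source `c • mmRead Lc (K3OfK X̃♮_j Lc S M W) + cB • B`
# equals `c·(−K_j²)·Σ_{r′∈box P, r′_μ exit_P} Σ'_{u′, u′_ν exit_P} ( FF^{Lc·P}[(dM_μ∘X̃♮_j)∘dM_ν] + FF^{Lc·P}[(dM_ν∘X̃♮_j)∘dM_μ] − FF^{Lc·P}[W_{μν}] )`, the leg masks on the
# exit class of period `Lc·P` (K6c is the case `P = Lc`) — Part 47 of `GAN24/FourFaceGaugeSectors` (G-an2-4 CRUX TEAM (2), leaf prover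
# `b2b-balaban-gan24-formalise-leaf-02`, gen 69): the INPUT of Part 45 `FaceWordsDeepCurrents` ∕ Part 46 `DressedVertexFacePush`

NOT IN PRINT; OUR BOOKKEEPING ([folklore] `tsum` bookkeeping BY NAME over leaf-06 g54's K6b `DressedStepFaceChargesWeighted.hasSum_mmRead_K3OfK_dressedStep_weight` at the
weights `f = g = [· % P = P − 1]` and leaf-04 g62's `FaceWeightedSandwich.emod_mul_eq_iff` (`[u % Lc = Lc−1]·[⌊u∕Lc⌋ % P = P−1] = [u % (Lc·P) = Lc·P−1]`); the text is leaf-06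
g54's K6c `FourFaceSourceWords` with the coarse period generalised — credit leaf-06; 0 `def`, 0 cited facts, 0 `def … : Prop`, 0 sorry).  HONEST FRAMING (cell contract,
verbatim): «discharging `BetaPertH` makes Bałaban's UV stability UNCONDITIONAL — a real constructive-QFT result; it is NOT the continuum limit and NOT the Clay problem.»
HONEST DEPENDENCY (verbatim): «continuum YM on T⁴ ⇐ BetaPertH ∧ nine spine estimates (0/9 proved); BetaPertH ⇐ (D1) ∧ (D4) ∧ CAP+tail; G-an2-4 gates asym, D1 and NE2/3/4.»

WHAT ([folklore]; in-block root, `1 ≤ Lc`, `1 ≤ P`, every `j`, all units, generic localised `S M W`, any border with zero ff block): (`ite_and_and_eq`, `sum_elim_and_charges` are leaf-06 K6c `FourFaceSourceWords`' ✓ BY NAME — v1.1 by courier leaf-06 g58 per [LEAF02-G69-HANDOFF] (iii)(a) «if leaf-06's K6c lands first drop 47's `ite_and_and_eq`∕`sum_elim_and_charges` and open theirs»; every other statement and proof byte-identical to v1 3ba21e109258c6b7),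
`deepMask_eq` (two periods), `readout_eq_deepFF` (K6b's `R[V]` at the period-`P` face weights `= −K_j²·FF^{Lc·P}[V]`), **`faceRead_dressedSource_inl_inl`**.
Asserts NO value of Bałaban's tables; discharges NOTHING of (C) ∕ (C)sym ∕ `hstep` ∕ `hSrc` ∕ `hSrcX`; NEVER «G-an2-4 closed» as (CONV-C); NOT D1, NOT `BetaPertH`, NOT continuum,
NOT Clay.  2026-08-24; no existing file touched.
-/

noncomputable section

open Finset
open scoped BigOperators
open Literature.MathematicalPhysics.QuantumFieldTheory
open Literature.MathematicalPhysics.QuantumFieldTheory.Balaban1983to89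
open Literature.MathematicalPhysics.QuantumFieldTheory.Balaban1983to89.Beta
open ExpKernelCalculus (Site MKer comp)
open OneStepResolventKernel (Fib)
open SecondOrderResponse (dM)
open BalabanStepW2 (K3OfK)
open BalabanStepJetsSucc (mmRead)
open OneStepKernelFamily (KInvStep)
open AffineAveraging (box toSite)
open AveragingContours (blk)
open Summit.QuantumFields.BalabanUV.Beta.TameKernelCalculus (Loc)
open Summit.QuantumFields.BalabanUV.Beta.BorderedHessian (stepScale)
open Summit.QuantumFields.BalabanUV.Beta.AxialDressingRooted (coDressKBmAt)
open Summit.QuantumFields.BalabanUV.Beta.HessKerDressedUnits (unitK)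
open Summit.QuantumFields.BalabanUV.Beta.GAN24.BiStencilZeroMode (Tab)
open Summit.QuantumFields.BalabanUV.Beta.GAN24.FaceWeightedSandwich (emod_mul_eq_iff)
open Summit.QuantumFields.BalabanUV.Beta.GAN24.DressedStepFaceChargesWeighted (hasSum_mmRead_K3OfK_dressedStep_weight)
open Summit.QuantumFields.BalabanUV.Beta.GAN24.FourFaceSourceWords (ite_and_and_eq sum_elim_and_charges)

namespace Summit.QuantumFields.BalabanUV.Beta.GAN24.FourFaceSourceWordsDeep

variable {d : ℕ} {Lc : ℕ} [NeZero Lc] {r : Fin (d + 1) → ℕ}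

/-! ## §1 Finite bookkeeping: masks and fibre charges -/

omit [NeZero Lc] in
/-- [folklore] **THE TWO-SCALE EXIT CONDITION AS ONE DEEP MASK** (leaf-04's `emod_mul_eq_iff`, two periods): `[u % Lc = Lc−1]·(K·[⌊u∕Lc⌋ % P = P−1]) = K·[u % (Lc·P) = Lc·P−1]`. -/
theorem deepMask_eq {P : ℕ} (hLc : 0 < (Lc : ℤ)) (hP : 0 < (P : ℤ)) (u : ℤ) (K : ℝ) :
    (if u % (Lc : ℤ) = (Lc : ℤ) - 1 then K * (if u / (Lc : ℤ) % (P : ℤ) = (P : ℤ) - 1 then (1 : ℝ) else 0) else 0) =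
      K * (if u % ((Lc : ℤ) * (P : ℤ)) = (Lc : ℤ) * (P : ℤ) - 1 then (1 : ℝ) else 0) := by
  have h := emod_mul_eq_iff hLc hP u
  by_cases h1 : u % (Lc : ℤ) = (Lc : ℤ) - 1 <;> by_cases h2 : u / (Lc : ℤ) % (P : ℤ) = (P : ℤ) - 1
  · have h3 : u % ((Lc : ℤ) * (P : ℤ)) = (Lc : ℤ) * (P : ℤ) - 1 := h.2 ⟨h1, h2⟩
    simp [h1, h2, h3]
  · have h3 : ¬ u % ((Lc : ℤ) * (P : ℤ)) = (Lc : ℤ) * (P : ℤ) - 1 := fun h3 => h2 (h.1 h3).2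
    simp [h1, h2, h3]
  · have h3 : ¬ u % ((Lc : ℤ) * (P : ℤ)) = (Lc : ℤ) * (P : ℤ) - 1 := fun h3 => h1 (h.1 h3).1
    simp [h1, h3]
  · have h3 : ¬ u % ((Lc : ℤ) * (P : ℤ)) = (Lc : ℤ) * (P : ℤ) - 1 := fun h3 => h1 (h.1 h3).1
    simp [h1, h3]

/-- [folklore] **K6b's READ-OUT WORD AT THE FACE WEIGHTS (period `P`) IS `−K_j²` TIMES THE TWO-FACE WORD AT THE EXIT CLASS OF PERIOD `Lc·P`**: for any two-leg table `V`,
`Σ'_{(y,w)} Σ_{f,g} ρL^χ f y·V y w f g·ρR^χ g w = −K_j²·Σ'_{(y,w)} [y_α % (Lc·P) = Lc·P−1]·[w_β % (Lc·P) = Lc·P−1]·V y w (inl α)(inl β)`. -/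
theorem readout_eq_deepFF {P : ℕ} (hP : 1 ≤ P) (sf sm : ℝ) (j : ℕ) (α β : Fin (d + 1)) (V : MKer (d + 1) (Fib d)) :
    (∑' yw : Site (d + 1) × Site (d + 1), ∑ φ' : Fib d, ∑ γ' : Fib d,
            Sum.elim (fun a => if a = α ∧ yw.1 α % (Lc : ℤ) = (Lc : ℤ) - 1 then -((sf * sm) * ((stepScale d Lc j * (Lc : ℝ) ^ (d + 1))⁻¹ * (fun s : ℤ => if s % (P : ℤ) = (P : ℤ) - 1 then (1 : ℝ) else 0) (blk Lc yw.1 α))) else 0)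
              (fun _ => (0 : ℝ)) φ' *
            V yw.1 yw.2 φ' γ' *
            Sum.elim (fun b' => if b' = β ∧ yw.2 β % (Lc : ℤ) = (Lc : ℤ) - 1 then (sf * sm) * ((stepScale d Lc j * (Lc : ℝ) ^ (d + 1))⁻¹ * (fun s : ℤ => if s % (P : ℤ) = (P : ℤ) - 1 then (1 : ℝ) else 0) (blk Lc yw.2 β)) else 0)
              (fun _ => (0 : ℝ)) γ') =
      -(((sf * sm) * (stepScale d Lc j * (Lc : ℝ) ^ (d + 1))⁻¹) * ((sf * sm) * (stepScale d Lc j * (Lc : ℝ) ^ (d + 1))⁻¹)) * ∑' yw : Site (d + 1) × Site (d + 1),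
        (if yw.1 α % ((Lc : ℤ) * (P : ℤ)) = (Lc : ℤ) * (P : ℤ) - 1 then (1 : ℝ) else 0) * (if yw.2 β % ((Lc : ℤ) * (P : ℤ)) = (Lc : ℤ) * (P : ℤ) - 1 then (1 : ℝ) else 0) *
          V yw.1 yw.2 (Sum.inl α) (Sum.inl β) := by
  classical
  have hLc : 0 < (Lc : ℤ) := by exact_mod_cast Nat.pos_of_ne_zero (NeZero.ne Lc)
  have hP0 : 0 < (P : ℤ) := by exact_mod_cast hP
  rw [← tsum_mul_left]
  refine tsum_congr fun yw => ?_
  rw [sum_elim_and_charges]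
  have hL : (if yw.1 α % (Lc : ℤ) = (Lc : ℤ) - 1 then -((sf * sm) * ((stepScale d Lc j * (Lc : ℝ) ^ (d + 1))⁻¹ * (fun s : ℤ => if s % (P : ℤ) = (P : ℤ) - 1 then (1 : ℝ) else 0) (blk Lc yw.1 α))) else 0) =
      -(((sf * sm) * (stepScale d Lc j * (Lc : ℝ) ^ (d + 1))⁻¹) * (if yw.1 α % ((Lc : ℤ) * (P : ℤ)) = (Lc : ℤ) * (P : ℤ) - 1 then (1 : ℝ) else 0)) := by
    rw [← deepMask_eq hLc hP0]
    simp only [blk]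
    split_ifs <;> ring
  have hR : (if yw.2 β % (Lc : ℤ) = (Lc : ℤ) - 1 then (sf * sm) * ((stepScale d Lc j * (Lc : ℝ) ^ (d + 1))⁻¹ * (fun s : ℤ => if s % (P : ℤ) = (P : ℤ) - 1 then (1 : ℝ) else 0) (blk Lc yw.2 β)) else 0) =
      ((sf * sm) * (stepScale d Lc j * (Lc : ℝ) ^ (d + 1))⁻¹) * (if yw.2 β % ((Lc : ℤ) * (P : ℤ)) = (Lc : ℤ) * (P : ℤ) - 1 then (1 : ℝ) else 0) := by
    rw [← deepMask_eq hLc hP0]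
    simp only [blk]
    split_ifs <;> ring
  rw [hL, hR]
  ring

/-! ## §2 The face read at period `P` of the dressed one-step source -/

/-- [folklore] **THE FACE READ AT COARSE PERIOD `P` OF THE DRESSED ONE-STEP SOURCE** (road-P2 g50's literal `FF_P`: cell `box P`, bonds outside, legs inside, one conjunctive
exit-face mask at period `P`): `Σ_{r′∈box P} Σ'_{u′} Σ'_x Σ'_z [r′_μ, u′_ν, x_α, z_β exit_P]·(c • mmRead Lc (K3OfK X̃♮_j Lc S M W μ r′ ν u′) + cB • B μ r′ ν u′) x z (inl α)(inl β)
 = c·(−K_j²)·Σ_{r′∈box P} Σ'_{u′} [r′_μ, u′_ν exit_P]·( FF^{Lc·P}[(dM_μ∘X̃♮_j)∘dM_ν] + FF^{Lc·P}[(dM_ν∘X̃♮_j)∘dM_μ] − FF^{Lc·P}[W_{μν}] )` — leaf-06 K6c at every period. -/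
theorem faceRead_dressedSource_inl_inl (hLc : 1 ≤ Lc) (hr : r ∈ box (d + 1) Lc) {P : ℕ} (hP : 1 ≤ P) (sf sm : ℝ) (j : ℕ)
    {S M : Fin (d + 1) → Site (d + 1) → MKer (d + 1) (Fib d)}
    {W : Fin (d + 1) → Site (d + 1) → Fin (d + 1) → Site (d + 1) → MKer (d + 1) (Fib d)} {B : Tab d} (c cB : ℝ)
    (hb : ∀ (κ : Fin (d + 1)) (y : Site (d + 1)), Loc (dM (unitK sf sm (coDressKBmAt (toSite r) Lc (KInvStep (d := d) Lc j))) Lc S M κ y))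
    (hW : ∀ (κ : Fin (d + 1)) (y : Site (d + 1)) (κ' : Fin (d + 1)) (y' : Site (d + 1)), Loc (W κ y κ' y'))
    (hBff : ∀ κ u κ' u' x z (α β : Fin (d + 1)), B κ u κ' u' x z (Sum.inl α) (Sum.inl β) = 0) (μ ν α β : Fin (d + 1)) :
    ∑ r' ∈ box (d + 1) P, ∑' u' : Site (d + 1), ∑' x : Site (d + 1), ∑' z : Site (d + 1),
        (if toSite r' μ % (P : ℤ) = (P : ℤ) - 1 ∧ u' ν % (P : ℤ) = (P : ℤ) - 1 ∧ x α % (P : ℤ) = (P : ℤ) - 1 ∧ z β % (P : ℤ) = (P : ℤ) - 1 then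
          (c • mmRead Lc (K3OfK (unitK sf sm (coDressKBmAt (toSite r) Lc (KInvStep (d := d) Lc j))) Lc S M W μ (toSite r') ν u') + cB • B μ (toSite r') ν u') x z (Sum.inl α) (Sum.inl β) else 0) =
      c * -(((sf * sm) * (stepScale d Lc j * (Lc : ℝ) ^ (d + 1))⁻¹) * ((sf * sm) * (stepScale d Lc j * (Lc : ℝ) ^ (d + 1))⁻¹)) * ∑ r' ∈ box (d + 1) P, ∑' u' : Site (d + 1),
        (if toSite r' μ % (P : ℤ) = (P : ℤ) - 1 ∧ u' ν % (P : ℤ) = (P : ℤ) - 1 then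
          ((∑' yw : Site (d + 1) × Site (d + 1),
              (if yw.1 α % ((Lc : ℤ) * (P : ℤ)) = (Lc : ℤ) * (P : ℤ) - 1 then (1 : ℝ) else 0) * (if yw.2 β % ((Lc : ℤ) * (P : ℤ)) = (Lc : ℤ) * (P : ℤ) - 1 then (1 : ℝ) else 0) *
                comp (comp (dM (unitK sf sm (coDressKBmAt (toSite r) Lc (KInvStep (d := d) Lc j))) Lc S M μ (toSite r')) (unitK sf sm (coDressKBmAt (toSite r) Lc (KInvStep (d := d) Lc j)))) (dM (unitK sf sm (coDressKBmAt (toSite r) Lc (KInvStep (d := d) Lc j))) Lc S M ν u') yw.1 yw.2 (Sum.inl α) (Sum.inl β)) +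
          (∑' yw : Site (d + 1) × Site (d + 1),
              (if yw.1 α % ((Lc : ℤ) * (P : ℤ)) = (Lc : ℤ) * (P : ℤ) - 1 then (1 : ℝ) else 0) * (if yw.2 β % ((Lc : ℤ) * (P : ℤ)) = (Lc : ℤ) * (P : ℤ) - 1 then (1 : ℝ) else 0) *
                comp (comp (dM (unitK sf sm (coDressKBmAt (toSite r) Lc (KInvStep (d := d) Lc j))) Lc S M ν u') (unitK sf sm (coDressKBmAt (toSite r) Lc (KInvStep (d := d) Lc j)))) (dM (unitK sf sm (coDressKBmAt (toSite r) Lc (KInvStep (d := d) Lc j))) Lc S M μ (toSite r')) yw.1 yw.2 (Sum.inl α) (Sum.inl β)) -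
          (∑' yw : Site (d + 1) × Site (d + 1),
              (if yw.1 α % ((Lc : ℤ) * (P : ℤ)) = (Lc : ℤ) * (P : ℤ) - 1 then (1 : ℝ) else 0) * (if yw.2 β % ((Lc : ℤ) * (P : ℤ)) = (Lc : ℤ) * (P : ℤ) - 1 then (1 : ℝ) else 0) *
                W μ (toSite r') ν u' yw.1 yw.2 (Sum.inl α) (Sum.inl β)))
        else 0) := by
  classical
  have hχ : ∀ s : ℤ, |(fun s : ℤ => if s % (P : ℤ) = (P : ℤ) - 1 then (1 : ℝ) else 0) s| ≤ 1 := by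
    intro s; simp only; split_ifs <;> simp
  rw [Finset.mul_sum]
  refine Finset.sum_congr rfl fun r' _ => ?_
  rw [← tsum_mul_left]
  refine tsum_congr fun u' => ?_
  by_cases hA : toSite r' μ % (P : ℤ) = (P : ℤ) - 1
  · by_cases hB : u' ν % (P : ℤ) = (P : ℤ) - 1
    · simp only [hA, hB, true_and, if_true]
      have h := hasSum_mmRead_K3OfK_dressedStep_weight (d := d) hLc hr sf sm j (hb μ (toSite r')) (hb ν u') (hW μ (toSite r') ν u') α β
        (fun s : ℤ => if s % (P : ℤ) = (P : ℤ) - 1 then (1 : ℝ) else 0) (fun s : ℤ => if s % (P : ℤ) = (P : ℤ) - 1 then (1 : ℝ) else 0) hχ hχ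
      have hpt : ∀ x z : Site (d + 1), (if x α % (P : ℤ) = (P : ℤ) - 1 ∧ z β % (P : ℤ) = (P : ℤ) - 1 then
            (c • mmRead Lc (K3OfK (unitK sf sm (coDressKBmAt (toSite r) Lc (KInvStep (d := d) Lc j))) Lc S M W μ (toSite r') ν u') + cB • B μ (toSite r') ν u') x z (Sum.inl α) (Sum.inl β) else 0) =
          c * ((fun s : ℤ => if s % (P : ℤ) = (P : ℤ) - 1 then (1 : ℝ) else 0) (x α) * (fun s : ℤ => if s % (P : ℤ) = (P : ℤ) - 1 then (1 : ℝ) else 0) (z β) *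
            mmRead Lc (K3OfK (unitK sf sm (coDressKBmAt (toSite r) Lc (KInvStep (d := d) Lc j))) Lc S M W μ (toSite r') ν u') x z (Sum.inl α) (Sum.inl β)) := by
        intro x z
        rw [ite_and_and_eq]
        simp only [Pi.add_apply, Pi.smul_apply, smul_eq_mul, hBff, mul_zero, add_zero]
        ring
      simp only [hpt, tsum_mul_left]
      rw [← h.summable.tsum_prod, h.tsum_eq, readout_eq_deepFF hP, readout_eq_deepFF hP, readout_eq_deepFF hP]
      ring
    · simp [hA, hB]
  · simp [hA]

end Summit.QuantumFields.BalabanUV.Beta.GAN24.FourFaceSourceWordsDeep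

end
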